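import Summits.QuantumFields.YangMills.Theorems.SlowBitWindowPersistenceChain
import HarnessLib

/-!
# Antipodal persistence of the Polyakov sign bit along the closed `2L`-chain:
# `insTrace L β O L ≥ Z_phys(2L) − 2·insTrace L β 𝟙_A 0 − 2(2L−1)·e^{β(2|E|−t²/2)}(e^{2β|E|})^{2L−1}`

Support module for the WEAK small-ball door onto `SwapTwistDeficit.TwistDeficitLaplaceWindow` (stmt-QuantumFields-23776, Laplace window W of LINE g11-A,
seat ym-idea-4).  The companion door `…SmallBallDoor` goes through the ONE-STEP autocorrelation (the slow bit of `SlowBitWindow`), which forces the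
small-ball hypothesis to have probability `≤ β^{−a}`.  For W alone the ANTIPODAL correlation `insTrace L β O L` (time separation `L`) suffices
(`CauchySchwarzDoor`), and it needs only `insTrace(O,L) ≥ β^{−k} Z`: the sign bit must not be COMPLETELY randomised after `L` steps.  This module proves the
deterministic and path-space halves of that statement:

* §1 `abs_polDist_slices_sub_le`, `signWitness_mul_eq_one_steps`, `one_sub_le_signWitness_mul_antipodal`: if every link moves by at most `t` in each of the
  `2L−1` bonds of the chain and `|polDist U₀ − polDist (S U₀)| > 2L·m·t`, then the sign witness agrees at slices `0` and `m`; hence pointwise on the slice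
  space `O(U₀)O(U_m) ≥ 1 − 2·𝟙_A(U₀) − 2·Σ_bonds 𝟙[bond is t-far]`, `A` the strip of width `2Lmt`;
* §2 `chain_mul_indicator_far_le` (any bond), ★ `insTrace_ge_of_persistence_sum`: for a measurable `|O| ≤ 1` satisfying that pointwise inequality at slot
  `m`, `insTrace L β O m ≥ Z_phys(2L) − 2·insTrace L β 𝟙_A 0 − 2(2L−1)·e^{β(2|E|−t²/2)}(e^{2β|E|})^{2L−2}e^{2β|E|}`.

HONEST FRAMING: fixed-lattice bookkeeping for a reduction (door); no semiclassics/RG; nothing about infinite volume, the continuum limit or the Clay gap.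
No `sorry`, no new axiom, no new definition.  References: [cite: MadrasSokal1988, §2]; [cite: MontvayMunster1994, (3.145)]; [cite: SeilerLNP1982, §3].
-/

set_option autoImplicit false

noncomputable section

open MeasureTheory Filter Topology Real Function
open scoped Matrix ComplexConjugate BigOperators
open Literature.MathematicalPhysics.QuantumLattice
open Literature.MathematicalPhysics.QuantumFieldTheory hiding SU2
open Summit.QuantumFields.YangMills.Theorems

namespace Summit.QuantumFields.YangMills.Theorems.FemtoTransferGap.FlatSheet

open Summit.QuantumFields.YangMills.Theorems.FemtoTransferGap

variable {L : ℕ}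

/-! ## §1 Multi-step persistence of the sign witness -/

/-- **Telescoping Lipschitz bound along the chain**: if in every bond all links move by at most `t`, then after `j` bonds `polDist` has moved by at most
`j·(L·t)`, and so has `polDist ∘ S`. [folklore] -/
theorem abs_polDist_slices_sub_le {n : ℕ} (Us : Fin (n + 1) → GaugeConfig 3 L SU2) {t : ℝ}
    (hclose : ∀ (i : Fin n) (e : Edge 3 L),
      frobNorm ((Us i.castSucc e : Matrix (Fin 2) (Fin 2) ℂ) - (Us i.succ e : Matrix (Fin 2) (Fin 2) ℂ)) ≤ t) :
    ∀ j : ℕ, ∀ hj : j ≤ n,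
      |polDist (Us ⟨j, Nat.lt_succ_of_le hj⟩) - polDist (Us 0)| ≤ j * (L * t) ∧
        |polDist (configPerm (Equiv.swap (0 : Fin 3) 1) (Us ⟨j, Nat.lt_succ_of_le hj⟩)) -
            polDist (configPerm (Equiv.swap (0 : Fin 3) 1) (Us 0))| ≤ j * (L * t) := by
  intro j
  induction j with
  | zero => intro hj; simp
  | succ j ih =>
    intro hj
    have hj' : j ≤ n := Nat.le_of_succ_le hj
    obtain ⟨ih1, ih2⟩ := ih hj'
    set i : Fin n := ⟨j, hj⟩ with hi
    have hcs : (i.castSucc : Fin (n + 1)) = ⟨j, Nat.lt_succ_of_le hj'⟩ := Fin.ext rfl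
    have hsc : (i.succ : Fin (n + 1)) = ⟨j + 1, Nat.lt_succ_of_le hj⟩ := Fin.ext rfl
    have h1 : |polDist (Us i.succ) - polDist (Us i.castSucc)| ≤ L * t := by
      rw [abs_sub_comm]; exact abs_polDist_sub_le_of_forall _ _ fun k _ => hclose i (lineEdge L k)
    have h2 : |polDist (configPerm (Equiv.swap (0 : Fin 3) 1) (Us i.succ)) - polDist (configPerm (Equiv.swap (0 : Fin 3) 1) (Us i.castSucc))| ≤ L * t := by
      rw [abs_sub_comm]; exact abs_polDist_swap_sub_le_of_forall _ _ (hclose i)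
    rw [hcs] at h1 h2; rw [hsc] at h1 h2
    constructor
    · calc |polDist (Us ⟨j + 1, Nat.lt_succ_of_le hj⟩) - polDist (Us 0)|
          ≤ |polDist (Us ⟨j + 1, Nat.lt_succ_of_le hj⟩) - polDist (Us ⟨j, Nat.lt_succ_of_le hj'⟩)| +
              |polDist (Us ⟨j, Nat.lt_succ_of_le hj'⟩) - polDist (Us 0)| := abs_sub_le _ _ _
        _ ≤ L * t + j * (L * t) := add_le_add h1 ih1
        _ = (j + 1 : ℕ) * (L * t) := by push_cast; ring
    · calc |polDist (configPerm (Equiv.swap (0 : Fin 3) 1) (Us ⟨j + 1, Nat.lt_succ_of_le hj⟩)) - polDist (configPerm (Equiv.swap (0 : Fin 3) 1) (Us 0))|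
          ≤ |polDist (configPerm (Equiv.swap (0 : Fin 3) 1) (Us ⟨j + 1, Nat.lt_succ_of_le hj⟩)) -
                polDist (configPerm (Equiv.swap (0 : Fin 3) 1) (Us ⟨j, Nat.lt_succ_of_le hj'⟩))| +
              |polDist (configPerm (Equiv.swap (0 : Fin 3) 1) (Us ⟨j, Nat.lt_succ_of_le hj'⟩)) -
                polDist (configPerm (Equiv.swap (0 : Fin 3) 1) (Us 0))| := abs_sub_le _ _ _
        _ ≤ L * t + j * (L * t) := add_le_add h2 ih2
        _ = (j + 1 : ℕ) * (L * t) := by push_cast; ring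

/-- **Persistence over `m` steps**: if `|polDist U₀ − polDist (S U₀)| > 2L·m·t` and all links move by at most `t` in every bond, then the sign witness agrees at
slices `0` and `m`. [cite: MadrasSokal1988, §2] -/
theorem signWitness_mul_eq_one_steps {n : ℕ} (Us : Fin (n + 1) → GaugeConfig 3 L SU2) {t : ℝ} {m : ℕ} (hm : m ≤ n)
    (hfar : 2 * L * (m * t) < |polDist (Us 0) - polDist (configPerm (Equiv.swap (0 : Fin 3) 1) (Us 0))|)
    (hclose : ∀ (i : Fin n) (e : Edge 3 L),
      frobNorm ((Us i.castSucc e : Matrix (Fin 2) (Fin 2) ℂ) - (Us i.succ e : Matrix (Fin 2) (Fin 2) ℂ)) ≤ t) :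
    Real.sign (polDist (Us 0) - polDist (configPerm (Equiv.swap (0 : Fin 3) 1) (Us 0))) *
      Real.sign (polDist (Us ⟨m, Nat.lt_succ_of_le hm⟩) - polDist (configPerm (Equiv.swap (0 : Fin 3) 1) (Us ⟨m, Nat.lt_succ_of_le hm⟩))) = 1 := by
  obtain ⟨h1, h2⟩ := abs_polDist_slices_sub_le Us hclose m hm
  refine real_sign_mul_sign_eq_one (d := 2 * L * (m * t)) ?_ hfar
  calc |polDist (Us 0) - polDist (configPerm (Equiv.swap (0 : Fin 3) 1) (Us 0)) -
        (polDist (Us ⟨m, Nat.lt_succ_of_le hm⟩) - polDist (configPerm (Equiv.swap (0 : Fin 3) 1) (Us ⟨m, Nat.lt_succ_of_le hm⟩)))|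
      = |(polDist (configPerm (Equiv.swap (0 : Fin 3) 1) (Us ⟨m, Nat.lt_succ_of_le hm⟩)) - polDist (configPerm (Equiv.swap (0 : Fin 3) 1) (Us 0))) -
          (polDist (Us ⟨m, Nat.lt_succ_of_le hm⟩) - polDist (Us 0))| := by ring_nf
    _ ≤ |polDist (configPerm (Equiv.swap (0 : Fin 3) 1) (Us ⟨m, Nat.lt_succ_of_le hm⟩)) - polDist (configPerm (Equiv.swap (0 : Fin 3) 1) (Us 0))| +
          |polDist (Us ⟨m, Nat.lt_succ_of_le hm⟩) - polDist (Us 0)| := abs_sub _ _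
    _ ≤ m * (L * t) + m * (L * t) := add_le_add h2 h1
    _ = 2 * L * (m * t) := by ring

/-- ★ **Pointwise antipodal persistence inequality on the slice space**: for every chain `Us` of `n+1` slices, every `m ≤ n` and `t`,
`O(U₀)·O(U_m) ≥ 1 − 2·𝟙[|polDist U₀ − polDist (S U₀)| ≤ 2Lmt] − 2·Σ_{bonds i<n} 𝟙[some link of bond i is t-far]`. [cite: MadrasSokal1988, §2] -/
theorem one_sub_le_signWitness_mul_antipodal {n : ℕ} (Us : Fin (n + 1) → GaugeConfig 3 L SU2) (t : ℝ) {m : ℕ} (hm : m ≤ n) :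
    1 - 2 * Set.indicator {W : GaugeConfig 3 L SU2 | |polDist W - polDist (configPerm (Equiv.swap (0 : Fin 3) 1) W)| ≤ 2 * L * (m * t)}
          (fun _ => (1 : ℝ)) (Us 0) -
        2 * ∑ i : Fin n, Set.indicator {p : GaugeConfig 3 L SU2 × GaugeConfig 3 L SU2 |
            ∃ e, t < frobNorm ((p.1 e : Matrix (Fin 2) (Fin 2) ℂ) - (p.2 e : Matrix (Fin 2) (Fin 2) ℂ))} (fun _ => (1 : ℝ)) (Us i.castSucc, Us i.succ) ≤
      Real.sign (polDist (Us 0) - polDist (configPerm (Equiv.swap (0 : Fin 3) 1) (Us 0))) *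
        Real.sign (polDist (Us ⟨m, Nat.lt_succ_of_le hm⟩) - polDist (configPerm (Equiv.swap (0 : Fin 3) 1) (Us ⟨m, Nat.lt_succ_of_le hm⟩))) := by
  set D : Set (GaugeConfig 3 L SU2 × GaugeConfig 3 L SU2) :=
    {p | ∃ e, t < frobNorm ((p.1 e : Matrix (Fin 2) (Fin 2) ℂ) - (p.2 e : Matrix (Fin 2) (Fin 2) ℂ))} with hD
  have hprod : -1 ≤ Real.sign (polDist (Us 0) - polDist (configPerm (Equiv.swap (0 : Fin 3) 1) (Us 0))) *
      Real.sign (polDist (Us ⟨m, Nat.lt_succ_of_le hm⟩) - polDist (configPerm (Equiv.swap (0 : Fin 3) 1) (Us ⟨m, Nat.lt_succ_of_le hm⟩))) := by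
    have h1 := abs_signWitness_le_one (Us 0)
    have h2 := abs_signWitness_le_one (Us ⟨m, Nat.lt_succ_of_le hm⟩)
    have h3 : |Real.sign (polDist (Us 0) - polDist (configPerm (Equiv.swap (0 : Fin 3) 1) (Us 0))) *
        Real.sign (polDist (Us ⟨m, Nat.lt_succ_of_le hm⟩) - polDist (configPerm (Equiv.swap (0 : Fin 3) 1) (Us ⟨m, Nat.lt_succ_of_le hm⟩)))| ≤ 1 := by
      rw [abs_mul]; exact mul_le_one₀ h1 (abs_nonneg _) h2
    exact (abs_le.1 h3).1
  have hsum0 : 0 ≤ ∑ i : Fin n, D.indicator (fun _ => (1 : ℝ)) (Us i.castSucc, Us i.succ) :=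
    Finset.sum_nonneg fun i _ => Set.indicator_nonneg (fun _ _ => zero_le_one) _
  by_cases hs : Us 0 ∈ {W : GaugeConfig 3 L SU2 | |polDist W - polDist (configPerm (Equiv.swap (0 : Fin 3) 1) W)| ≤ 2 * L * (m * t)}
  · rw [Set.indicator_of_mem hs]; linarith
  rw [Set.indicator_of_notMem hs]
  by_cases hd : ∃ i : Fin n, (Us i.castSucc, Us i.succ) ∈ D
  · obtain ⟨i, hi⟩ := hd
    have h1 : (1 : ℝ) ≤ ∑ i : Fin n, D.indicator (fun _ => (1 : ℝ)) (Us i.castSucc, Us i.succ) := by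
      have := Finset.single_le_sum (f := fun i : Fin n => D.indicator (fun _ => (1 : ℝ)) (Us i.castSucc, Us i.succ))
        (fun i _ => Set.indicator_nonneg (fun _ _ => zero_le_one) _) (Finset.mem_univ i)
      rw [Set.indicator_of_mem hi] at this
      exact this
    linarith
  push Not at hd
  have hclose : ∀ (i : Fin n) (e : Edge 3 L),
      frobNorm ((Us i.castSucc e : Matrix (Fin 2) (Fin 2) ℂ) - (Us i.succ e : Matrix (Fin 2) (Fin 2) ℂ)) ≤ t := fun i e =>
    not_lt.1 fun h => hd i ⟨e, h⟩
  rw [signWitness_mul_eq_one_steps Us hm (not_le.1 hs) hclose]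
  linarith

end Summit.QuantumFields.YangMills.Theorems.FemtoTransferGap.FlatSheet

namespace Summit.QuantumFields.YangMills.Theorems.FemtoTransferGap.TT

open Summit.QuantumFields.YangMills.Theorems.FemtoTransferGap

variable {L : ℕ} [NeZero L]

/-! ## §2 The persistence bound along the chain with a sum over bonds -/

/-- **A far bond anywhere in the chain costs `e^{β(2|E|−t²/2)}·(e^{2β|E|})^{2L−2}·e^{2β|E|}`** (the far bond's kernel is exponentially small, the others
at most their supremum). [cite: SeilerLNP1982, §3] -/
theorem chain_mul_indicator_far_le {β : ℝ} (hβ : 0 ≤ β) {t : ℝ} (ht : 0 ≤ t) (i : Fin (2 * L - 1))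
    (Us : Fin (2 * L - 1 + 1) → GaugeConfig 3 L SU2) :
    (∏ j : Fin (2 * L - 1), transferKernel su2Rep β (Us j.castSucc) (Us j.succ)) *
          physAvg (transferKernel su2Rep β (Us (Fin.last (2 * L - 1)))) (Us 0) *
        Set.indicator {p : GaugeConfig 3 L SU2 × GaugeConfig 3 L SU2 |
            ∃ e, t < frobNorm ((p.1 e : Matrix (Fin 2) (Fin 2) ℂ) - (p.2 e : Matrix (Fin 2) (Fin 2) ℂ))} (fun _ => (1 : ℝ)) (Us i.castSucc, Us i.succ) ≤
      Real.exp (β * (2 * (Fintype.card (Edge 3 L) : ℝ) - t ^ 2 / 2)) *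
        (Real.exp (2 * β) ^ Fintype.card (Edge 3 L)) ^ (2 * L - 2) * Real.exp (2 * β) ^ Fintype.card (Edge 3 L) := by
  set E : ℕ := Fintype.card (Edge 3 L) with hE
  set M : ℝ := Real.exp (2 * β) ^ E with hM
  set η : ℝ := Real.exp (β * (2 * (E : ℝ) - t ^ 2 / 2)) with hη
  set D : Set (GaugeConfig 3 L SU2 × GaugeConfig 3 L SU2) :=
    {p | ∃ e, t < frobNorm ((p.1 e : Matrix (Fin 2) (Fin 2) ℂ) - (p.2 e : Matrix (Fin 2) (Fin 2) ℂ))} with hDdef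
  have hKM : ∀ U V : GaugeConfig 3 L SU2, transferKernel su2Rep β U V ≤ M := fun U V =>
    (le_abs_self _).trans (abs_transferKernel_le_lat hβ (U, V))
  have hPM : ∀ U V : GaugeConfig 3 L SU2, physAvg (transferKernel su2Rep β U) V ≤ M := fun U V =>
    (le_abs_self _).trans (abs_physAvg_le (fun W => abs_transferKernel_le_lat hβ (U, W)) V)
  have hsplit : (∏ j : Fin (2 * L - 1), transferKernel su2Rep β (Us j.castSucc) (Us j.succ)) =
      transferKernel su2Rep β (Us i.castSucc) (Us i.succ) *
        ∏ j ∈ Finset.univ.erase i, transferKernel su2Rep β (Us j.castSucc) (Us j.succ) := by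
    rw [← Finset.mul_prod_erase Finset.univ _ (Finset.mem_univ i)]
  have hrest : ∏ j ∈ Finset.univ.erase i, transferKernel su2Rep β (Us j.castSucc) (Us j.succ) ≤ M ^ (2 * L - 2) := by
    calc ∏ j ∈ Finset.univ.erase i, transferKernel su2Rep β (Us j.castSucc) (Us j.succ) ≤ ∏ _j ∈ Finset.univ.erase i, M :=
          Finset.prod_le_prod (fun j _ => (transferKernel_pos _ _ _ _).le) fun j _ => hKM _ _
      _ = M ^ (2 * L - 2) := by
          rw [Finset.prod_const, Finset.card_erase_of_mem (Finset.mem_univ _), Finset.card_univ, Fintype.card_fin,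
            show 2 * L - 1 - 1 = 2 * L - 2 by omega]
  have hrest0 : 0 ≤ ∏ j ∈ Finset.univ.erase i, transferKernel su2Rep β (Us j.castSucc) (Us j.succ) :=
    Finset.prod_nonneg fun j _ => (transferKernel_pos _ _ _ _).le
  have hKD : transferKernel su2Rep β (Us i.castSucc) (Us i.succ) * D.indicator (fun _ => (1 : ℝ)) (Us i.castSucc, Us i.succ) ≤ η := by
    simpa only [hDdef, hη, hE] using FlatSheet.transferKernel_mul_indicator_far_le hβ ht (Us i.castSucc) (Us i.succ)
  have hP0 : 0 ≤ physAvg (transferKernel su2Rep β (Us (Fin.last (2 * L - 1)))) (Us 0) :=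
    physAvg_nonneg (fun V => (transferKernel_pos _ _ _ V).le) _
  calc (∏ j : Fin (2 * L - 1), transferKernel su2Rep β (Us j.castSucc) (Us j.succ)) *
          physAvg (transferKernel su2Rep β (Us (Fin.last (2 * L - 1)))) (Us 0) * D.indicator (fun _ => (1 : ℝ)) (Us i.castSucc, Us i.succ)
      = (transferKernel su2Rep β (Us i.castSucc) (Us i.succ) * D.indicator (fun _ => (1 : ℝ)) (Us i.castSucc, Us i.succ)) *
          (∏ j ∈ Finset.univ.erase i, transferKernel su2Rep β (Us j.castSucc) (Us j.succ)) *
          physAvg (transferKernel su2Rep β (Us (Fin.last (2 * L - 1)))) (Us 0) := by rw [hsplit]; ring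
    _ ≤ η * M ^ (2 * L - 2) * M :=
        mul_le_mul (mul_le_mul hKD hrest hrest0 (Real.exp_pos _).le) (hPM _ _) hP0 (by positivity)

set_option maxHeartbeats 800000 in
/-- ★ **Persistence bound along the chain, summed over bonds.**  Let `O` be measurable with `|O| ≤ 1`, `A` a measurable slice event, `t ≥ 0`, a slot `m`,
and suppose pointwise on the slice space `O(U₀)O(U_m) ≥ 1 − 2·𝟙_A(U₀) − 2·Σ_{bonds} 𝟙[bond t-far]` (slot `m` read mod `2L`).  Then for `β ≥ 0`:
`insTrace L β O m ≥ Z_phys(2L) − 2·insTrace L β 𝟙_A 0 − 2(2L−1)·e^{β(2|E|−t²/2)}(e^{2β|E|})^{2L−2}e^{2β|E|}`. [cite: MadrasSokal1988, §2] [cite: SeilerLNP1982, §3] -/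
theorem insTrace_ge_of_persistence_sum {β : ℝ} (hβ : 0 ≤ β) {O : GaugeConfig 3 L SU2 → ℝ} (hOm : Measurable O)
    (hOb : ∀ U, |O U| ≤ 1) {A : Set (GaugeConfig 3 L SU2)} (hA : MeasurableSet A) {t : ℝ} (ht : 0 ≤ t) {m : ℕ}
    (hpt : ∀ Us : Fin (2 * L - 1 + 1) → GaugeConfig 3 L SU2,
      1 - 2 * A.indicator (fun _ => (1 : ℝ)) (Us 0) -
          2 * ∑ i : Fin (2 * L - 1), Set.indicator {p : GaugeConfig 3 L SU2 × GaugeConfig 3 L SU2 |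
              ∃ e, t < frobNorm ((p.1 e : Matrix (Fin 2) (Fin 2) ℂ) - (p.2 e : Matrix (Fin 2) (Fin 2) ℂ))} (fun _ => (1 : ℝ)) (Us i.castSucc, Us i.succ) ≤
        O (Us 0) * O (Us ⟨m % (2 * L - 1 + 1), Nat.mod_lt _ (Nat.succ_pos _)⟩)) :
    physTrace L β (2 * L) - 2 * insTrace L β (A.indicator fun _ => (1 : ℝ)) 0 -
        2 * (2 * L - 1 : ℕ) * (Real.exp (β * (2 * (Fintype.card (Edge 3 L) : ℝ) - t ^ 2 / 2)) *
          (Real.exp (2 * β) ^ Fintype.card (Edge 3 L)) ^ (2 * L - 2) * Real.exp (2 * β) ^ Fintype.card (Edge 3 L)) ≤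
      insTrace L β O m := by
  set E : ℕ := Fintype.card (Edge 3 L) with hE
  set M : ℝ := Real.exp (2 * β) ^ E with hM
  set η : ℝ := Real.exp (β * (2 * (E : ℝ) - t ^ 2 / 2)) with hη
  set D : Set (GaugeConfig 3 L SU2 × GaugeConfig 3 L SU2) :=
    {p | ∃ e, t < frobNorm ((p.1 e : Matrix (Fin 2) (Fin 2) ℂ) - (p.2 e : Matrix (Fin 2) (Fin 2) ℂ))} with hDdef
  set μ : Measure (Fin (2 * L - 1 + 1) → GaugeConfig 3 L SU2) := Measure.pi fun _ => configMeasure SU2 L with hμ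
  set F : (Fin (2 * L - 1 + 1) → GaugeConfig 3 L SU2) → ℝ := fun Us =>
    (∏ i : Fin (2 * L - 1), transferKernel su2Rep β (Us i.castSucc) (Us i.succ)) *
      physAvg (transferKernel su2Rep β (Us (Fin.last (2 * L - 1)))) (Us 0) with hF
  set s : Fin (2 * L - 1 + 1) := ⟨m % (2 * L - 1 + 1), Nat.mod_lt _ (Nat.succ_pos _)⟩ with hs
  have hFm : Measurable F := measurable_chain β
  have hF0 : ∀ Us, 0 ≤ F Us := chain_nonneg β
  have hFb : ∀ Us, |F Us| ≤ M ^ (2 * L - 1) * M := abs_chain_le hβ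
  -- (a) each far bond costs `η M^{2L-2} M`
  have hfar : ∀ (Us : Fin (2 * L - 1 + 1) → GaugeConfig 3 L SU2) (i : Fin (2 * L - 1)), F Us * D.indicator (fun _ => (1 : ℝ)) (Us i.castSucc, Us i.succ) ≤ η * M ^ (2 * L - 2) * M :=
    fun Us i => by simpa only [hF, hDdef, hη, hM, hE] using chain_mul_indicator_far_le hβ ht i Us
  have hfar_sum : ∀ Us, F Us * ∑ i : Fin (2 * L - 1), D.indicator (fun _ => (1 : ℝ)) (Us i.castSucc, Us i.succ) ≤
      (2 * L - 1 : ℕ) * (η * M ^ (2 * L - 2) * M) := fun Us => by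
    rw [Finset.mul_sum]
    calc ∑ i : Fin (2 * L - 1), F Us * D.indicator (fun _ => (1 : ℝ)) (Us i.castSucc, Us i.succ)
        ≤ ∑ _i : Fin (2 * L - 1), η * M ^ (2 * L - 2) * M := Finset.sum_le_sum fun i _ => hfar Us i
      _ = (2 * L - 1 : ℕ) * (η * M ^ (2 * L - 2) * M) := by rw [Finset.sum_const, Finset.card_univ, Fintype.card_fin, nsmul_eq_mul]
  -- (b) pointwise
  have hpoint : ∀ Us, F Us - 2 * (F Us * A.indicator (fun _ => (1 : ℝ)) (Us 0)) - 2 * ((2 * L - 1 : ℕ) * (η * M ^ (2 * L - 2) * M)) ≤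
      F Us * (O (Us 0) * O (Us s)) := by
    intro Us
    have h1 := mul_le_mul_of_nonneg_left (hpt Us) (hF0 Us)
    have h2 := hfar_sum Us
    nlinarith [h1, h2]
  -- (c) integrate
  have hind1 : ∀ Us : Fin (2 * L - 1 + 1) → GaugeConfig 3 L SU2, |A.indicator (fun _ => (1 : ℝ)) (Us 0)| ≤ 1 := fun Us => by
    by_cases hU : Us 0 ∈ A
    · rw [Set.indicator_of_mem hU, abs_one]
    · rw [Set.indicator_of_notMem hU, abs_zero]; exact zero_le_one
  have hIF : Integrable F μ := integrable_of_measurable_abs_le _ hFm hFb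
  have hIA : Integrable (fun Us => F Us * A.indicator (fun _ => (1 : ℝ)) (Us 0)) μ := by
    refine integrable_of_measurable_abs_le _ (hFm.mul ((measurable_const.indicator hA).comp (measurable_pi_apply 0))) (C := M ^ (2 * L - 1) * M) fun Us => ?_
    calc |F Us * A.indicator (fun _ => (1 : ℝ)) (Us 0)| = |F Us| * |A.indicator (fun _ => (1 : ℝ)) (Us 0)| := abs_mul _ _
      _ ≤ M ^ (2 * L - 1) * M * 1 := mul_le_mul (hFb Us) (hind1 Us) (abs_nonneg _) (by positivity)
      _ = M ^ (2 * L - 1) * M := mul_one _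
  have hIO : Integrable (fun Us => F Us * (O (Us 0) * O (Us s))) μ := by
    refine integrable_of_measurable_abs_le _ (hFm.mul ((hOm.comp (measurable_pi_apply 0)).mul (hOm.comp (measurable_pi_apply _))))
      (C := M ^ (2 * L - 1) * M) fun Us => ?_
    have hOO : |O (Us 0) * O (Us s)| ≤ 1 := by rw [abs_mul]; exact mul_le_one₀ (hOb _) (abs_nonneg _) (hOb _)
    calc |F Us * (O (Us 0) * O (Us s))| = |F Us| * |O (Us 0) * O (Us s)| := abs_mul _ _
      _ ≤ M ^ (2 * L - 1) * M * 1 := mul_le_mul (hFb Us) hOO (abs_nonneg _) (by positivity)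
      _ = M ^ (2 * L - 1) * M := mul_one _
  haveI : IsProbabilityMeasure μ := by rw [hμ]; infer_instance
  have h12 : Integrable (fun Us => F Us - 2 * (F Us * A.indicator (fun _ => (1 : ℝ)) (Us 0))) μ := hIF.sub (hIA.const_mul 2)
  have h3 : Integrable (fun _ : Fin (2 * L - 1 + 1) → GaugeConfig 3 L SU2 => 2 * ((2 * L - 1 : ℕ) * (η * M ^ (2 * L - 2) * M))) μ :=
    integrable_const _
  have h123 : Integrable (fun Us => F Us - 2 * (F Us * A.indicator (fun _ => (1 : ℝ)) (Us 0)) - 2 * ((2 * L - 1 : ℕ) * (η * M ^ (2 * L - 2) * M))) μ :=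
    h12.sub h3
  have hint := integral_mono h123 hIO hpoint
  rw [integral_sub h12 h3, integral_sub hIF (hIA.const_mul 2), integral_const_mul, integral_const, smul_eq_mul, probReal_univ,
    one_mul] at hint
  have hZ : physTrace L β (2 * L) = ∫ Us, F Us ∂μ := by simp only [physTrace, physTraceSucc, hF, hμ]
  have hS : insTrace L β (A.indicator fun _ => (1 : ℝ)) 0 = ∫ Us, F Us * A.indicator (fun _ => (1 : ℝ)) (Us 0) ∂μ := insTrace_indicator_zero β A
  have hI : insTrace L β O m = ∫ Us, F Us * (O (Us 0) * O (Us s)) ∂μ := by simp only [insTrace, hF, hμ, hs]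
  rw [hZ, hS, hI]
  have e1 : (2 : ℝ) * (2 * L - 1 : ℕ) * (η * M ^ (2 * L - 2) * M) = 2 * ((2 * L - 1 : ℕ) * (η * M ^ (2 * L - 2) * M)) := by ring
  rw [e1]
  exact hint

end Summit.QuantumFields.YangMills.Theorems.FemtoTransferGap.TT

end
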